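import Summits.ValiantsHypothesis.ValiantsHypothesis.Theses.SliceSignRank
import Summits.ValiantsHypothesis.ValiantsHypothesis.Theorems.SliceSignRankPositiveSliceNormalFormSplit

/-!
# ValiantsHypothesis / SliceSignRank — item `Assembly` (stmt-ValiantsHypothesis-15125), closed

The assembly item of route `SliceSignRank` is literally the type of the route's deciding theorem
`Theses.SliceSignRank.closes` (SignRankSuperQP → PositiveSliceNormalForm → ValiantsHypothesis); it is proved by `closes` itself. HONEST FRAMING: bookkeeping; the
hypotheses are OPEN cruxes; nothing here is progress on `VP ≠ VNP`.
-/

-- layout Summits/ValiantsHypothesis/ValiantsHypothesis forces the duplicated namespace component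
set_option linter.dupNamespace false

namespace Summit.ValiantsHypothesis.ValiantsHypothesis.Theorems.SliceSignRank

/-- **Item `Assembly` (stmt-ValiantsHypothesis-15125):** SignRankSuperQP → PositiveSliceNormalForm → ValiantsHypothesis — the route's deciding theorem `closes`. [folklore] -/
theorem assembly_proof : Theses.SliceSignRank.Assembly := by
  unfold Theses.SliceSignRank.Assembly
  intro hS hF
  -- buildfix (bf3-g27, 2026-08-27): route `SliceSignRank` rev 3 (22:40Z) re-keyed `closes` to the SPLIT
  -- children `SrkNotQP` / `PositiveSliceSignTransfer`; this CLOSED assembly item keeps its accepted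
  -- statement (`SignRankSuperQP → PositiveSliceNormalForm → VH`), so the chain of `closes` is inlined with
  -- `hF` taken as the hypothesis it is here and `SrkNotQP` obtained from `SignRankSuperQP` by the landed
  -- `srkNotQP_of_signRankSuperQP` (…PositiveSliceNormalFormSplit). Statement byte-identical.
  have hK := Summit.ValiantsHypothesis.ValiantsHypothesis.Theorems.SliceSignRankPositiveSliceNormalFormSplit.srkNotQP_of_signRankSuperQP hS
  show Literature.Computability.AlgebraicComplexity.VP ℂ ≠ Literature.Computability.AlgebraicComplexity.VNP ℂ
  intro hEq
  have hbridge : Literature.Computability.AlgebraicComplexity.perFamily ℂ ∈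
      Literature.Computability.AlgebraicComplexity.VP ℂ ↔
      Literature.Computability.AlgebraicComplexity.IsVPFamily
        (fun n => Literature.Computability.AlgebraicComplexity.perPoly (Fin n) ℂ) :=
    Literature.Computability.AlgebraicComplexity.mem_VP_ofFintype_iff_holds _
  have hVP : Literature.Computability.AlgebraicComplexity.IsVPFamily
      (fun n => Literature.Computability.AlgebraicComplexity.perPoly (Fin n) ℂ) := by
    refine hbridge.1 ?_
    rw [hEq]
    exact Literature.Computability.AlgebraicComplexity.perFamily_mem_VNP_holds ℂ
  -- the permanent is a positive slice family: supported on permutation monomials, coefficient 1 each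
  have h0 : ∀ (n : ℕ) (d : Fin n × Fin n →₀ ℕ),
      (∀ ρ : Equiv.Perm (Fin n), Literature.Computability.AlgebraicComplexity.permMonomial ρ ≠ d) →
        MvPolynomial.coeff d (Literature.Computability.AlgebraicComplexity.perPoly (Fin n) ℂ) = 0 := by
    intro n d hd
    rw [Literature.Computability.AlgebraicComplexity.coeff_perPoly]
    exact Finset.sum_eq_zero fun ρ _ => if_neg (hd ρ)
  have h1 : ∀ (n : ℕ) (ρ : Equiv.Perm (Fin n)), ∃ r : ℝ, 0 < r ∧
      MvPolynomial.coeff (Literature.Computability.AlgebraicComplexity.permMonomial ρ)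
        (Literature.Computability.AlgebraicComplexity.perPoly (Fin n) ℂ) = (r : ℂ) := by
    intro n ρ
    refine ⟨1, one_pos, ?_⟩
    rw [Literature.Computability.AlgebraicComplexity.coeff_permMonomial_perPoly]
    simp
  -- transfer (derived parent): a quasi-polynomial real fermionic normal form of per_n for all n ≥ 1 …
  obtain ⟨c, hc⟩ := hF _ h0 h1 hVP
  -- … which SrkNotQP forbids at its witness n ≥ 1 for this c
  obtain ⟨n, hn1, hn⟩ := hK c
  obtain ⟨k, hk, W, hW⟩ := hc n hn1
  refine hn k hk ⟨W, fun σ => ?_⟩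
  have h := hW σ
  rw [Literature.Computability.AlgebraicComplexity.coeff_permMonomial_perPoly] at h
  have h' : (((Equiv.Perm.sign σ : ℤ) : ℝ) * ∑ t, ∏ i, W t (σ i) i : ℝ) = 1 := by
    apply Complex.ofReal_injective
    push_cast
    exact h.symm
  rw [h']
  exact one_pos

end Summit.ValiantsHypothesis.ValiantsHypothesis.Theorems.SliceSignRank
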